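import Summits.Ventures.LatticeQCDFlow.Scoring.SU2TorusPolyakovLoopSquare
import Summits.Ventures.LatticeQCDFlow.Scoring.SU2TorusPlaquetteLimit
import Summits.Ventures.LatticeQCDFlow.Scoring.SU2TorusPlaquetteEnclosures
import HarnessLib

/-!
# SU(2) on the 2-torus: `¼ ≤ ⟨(½ tr P)²⟩_{(ℤ/L)²,β} ≤ ¼ + ¼ r^{L²−1} Σ_n I_{n+2}/I₁` and `⟨(½ tr P)²⟩ → ¼` — the Polyakov loop is Haar-distributed in the thermodynamic limit, to second order

HONEST FRAMING: exact (Metropolis-corrected) sampling algorithms for lattice gauge theory;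
figures of merit are autocorrelation/cost numbers at stated couplings and volumes; no
continuum-physics claim.

Venture `LatticeQCDFlow` (cell pub-lqcd), sub-topic `Scoring`; FANOUT row 5 (`s0-sun-a`), GEN-12.
NEW WORK of the cell (placement rule); the finite-volume analysis of GEN-11's exact mean square
`wilson_mean_su2a0_sq_polyakov_two`: `⟨(½ tr P_j)²⟩_{(ℤ/L)²,β} = ¼ Σ_n (1 + [n ≠ 0]) λ_n^{L²} / Σ_n λ_n^{L²}`
(`λ_n = e^{−2β}(I_n(2β) − I_{n+2}(2β))/(n+1)`; oracle X02's `⟨|l|²⟩`, the `R = 0` entry of `polyakov_2pt`).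

* `tsum_ite_div_sub_quarter_mem` — abstract: for antitone positive summable `w` and `V ≥ 1`,
  `0 ≤ (¼ Σ_n (1+[n≠0]) w_n^V)/(Σ_n w_n^V) − ¼ ≤ ¼ (w_1/w_0)^{V−1} (Σ_n w_{n+1})/w_0`;
* **`wilson_mean_su2a0_sq_polyakov_two_sub_quarter_mem`** — for `β > 0` and every `L ≥ 1`:
  `0 ≤ ⟨(½ tr P_j)²⟩_{(ℤ/L)²,β} − ¼ ≤ ¼ (I₂(2β)/I₁(2β))^{L²−1} · Σ_n I_{n+2}(2β)/I₁(2β)`, and the ELEMENTARY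
  form `… ≤ ¼ (e^β − 1)(β/2)^{L²−1}` (`_explicit`): the mean square of the Polyakov loop exceeds the Haar
  second moment `∫ (½ tr U)² dU = ¼` by an amount exponentially small in the VOLUME;
* **`tendsto_wilson_mean_su2a0_sq_polyakov_two`** — `⟨(½ tr P_0)²⟩_{(ℤ/(L+1))²,β} → ¼` as `L → ∞`.

With `SU2TorusPolyakovLoops` (`⟨½ tr P⟩ = 0` exactly) and `SU2TorusPolyakovLoopsFiniteVolume` (the
two-point function `¼(r^{LT} + r^{L(L−T)})` up to `½ r^{L²−1} Σ I_{n+2}/I₁`): the first two moments of a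
single Polyakov loop are those of a Haar-random `SU(2)` element up to `O(r^{L²−1})`, while two loops at
distance `T` are correlated at order `r^{LT}`.  X02 check: `L = 4`, `b = 2.2`: `¼ + ¼ Σ_{n≥1}λ_n^{16}/Z =
0.2500012` (T5 Metropolis `0.24997(21)`).  Elementary given GEN-11; nothing is cited; no `def`.
-/

noncomputable section

open Real MeasureTheory Set Function Finset Filter Topology Polynomial.Chebyshev
open Literature.MathematicalPhysics.QuantumFieldTheory Literature.MathematicalPhysics.QuantumLattice
open Literature.Analysis.FunctionSpaces
open Summit.Ventures.LatticeQCDFlow.Exactness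
open Summit.Ventures.LatticeQCDFlow.Theory2.Lattice

namespace Summit.Ventures.LatticeQCDFlow.Scoring

/-! ## §1. The abstract estimate -/

section Abstract

variable {w : ℕ → ℝ} (hanti : Antitone w) (hpos : ∀ n, 0 < w n) (hsum : Summable w)
include hanti hpos hsum

/-- **Abstract form.**  For an antitone, positive, summable `w : ℕ → ℝ` and `V ≥ 1`: with
`Z = Σ_n w_n^V` and `N = ¼ Σ_n (1 + [n ≠ 0]) w_n^V`,
`0 ≤ N/Z − ¼ ≤ ¼ (w_1/w_0)^{V−1} · (Σ_n w_{n+1})/w_0` (`N − ¼Z = ¼ Σ_{n≥1} w_n^V` and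
`w_n^V ≤ w_1^{V−1} w_n` for `n ≥ 1`, `Z ≥ w_0^V`). -/
theorem tsum_ite_div_sub_quarter_mem (V : ℕ) (hV : 1 ≤ V) :
    0 ≤ (∑' n : ℕ, (1 / 4 : ℝ) * (if n = 0 then 1 else 2) * w n ^ V) / (∑' n : ℕ, w n ^ V) - 1 / 4 ∧
      (∑' n : ℕ, (1 / 4 : ℝ) * (if n = 0 then 1 else 2) * w n ^ V) / (∑' n : ℕ, w n ^ V) - 1 / 4 ≤
        1 / 4 * (w 1 / w 0) ^ (V - 1) * ((∑' n : ℕ, w (n + 1)) / w 0) := by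
  obtain ⟨v, rfl⟩ : ∃ v, V = v + 1 := ⟨V - 1, by omega⟩
  simp only [Nat.add_sub_cancel]
  set N : ℝ := ∑' n : ℕ, (1 / 4 : ℝ) * (if n = 0 then 1 else 2) * w n ^ (v + 1) with hN
  set Z : ℝ := ∑' n : ℕ, w n ^ (v + 1) with hZ
  set S : ℝ := ∑' n : ℕ, w (n + 1) with hS
  set r : ℝ := w 1 / w 0 with hr
  have hw0 := hpos 0
  have hw1 := hpos 1
  have hS0 : 0 ≤ S := tsum_nonneg fun n => (hpos _).le
  have hr0 : 0 ≤ r := by positivity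
  have hsumZ : Summable fun n => w n ^ (v + 1) := summable_pow_of_antitone hanti hpos hsum _ (by omega)
  have hsumN : Summable fun n : ℕ => (1 / 4 : ℝ) * (if n = 0 then 1 else 2) * w n ^ (v + 1) := by
    refine Summable.of_nonneg_of_le (fun n => ?_) (fun n => ?_) (hsumZ.mul_left (1 / 2))
    · have := (hpos n).le; positivity
    · have h0 : 0 ≤ w n ^ (v + 1) := pow_nonneg (hpos n).le _
      split_ifs <;> nlinarith
  have hsumS : Summable fun n => w (n + 1) := (summable_nat_add_iff 1).mpr hsum
  have hZge : w 0 ^ (v + 1) ≤ Z := hsumZ.le_tsum 0 (fun j _ => pow_nonneg (hpos j).le _)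
  have hZpos : 0 < Z := lt_of_lt_of_le (pow_pos hw0 _) hZge
  -- the difference as one series with vanishing head
  set D : ℕ → ℝ := fun n => (1 / 4 : ℝ) * (if n = 0 then 1 else 2) * w n ^ (v + 1) -
    1 / 4 * w n ^ (v + 1) with hD
  have hsumD : Summable D := hsumN.sub (hsumZ.mul_left _)
  have hdiff : N - 1 / 4 * Z = ∑' n, D n := by
    rw [hN, hZ, ← tsum_mul_left, ← hsumN.tsum_sub (hsumZ.mul_left _)]
  have hD0 : D 0 = 0 := by
    rw [hD]
    simp
  have hDsucc : ∀ n, D (n + 1) = 1 / 4 * w (n + 1) ^ (v + 1) := by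
    intro n
    rw [hD]
    simp only [Nat.succ_ne_zero, if_false]
    ring
  have hsumDtail : Summable fun n => D (n + 1) := (summable_nat_add_iff 1).mpr hsumD
  have htail_nonneg : 0 ≤ ∑' n, D (n + 1) :=
    tsum_nonneg fun n => by rw [hDsucc]; have := (hpos (n + 1)).le; positivity
  have htail_le : ∑' n, D (n + 1) ≤ 1 / 4 * (w 1 ^ v * S) := by
    have hb : ∀ n, D (n + 1) ≤ 1 / 4 * (w 1 ^ v * w (n + 1)) := by
      intro n
      rw [hDsucc, pow_succ]
      have hq : w (n + 1) ^ v ≤ w 1 ^ v := pow_le_pow_left₀ (hpos (n + 1)).le (hanti (by omega)) _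
      have := (hpos (n + 1)).le
      nlinarith
    calc ∑' n, D (n + 1) ≤ ∑' n, 1 / 4 * (w 1 ^ v * w (n + 1)) :=
          hsumDtail.tsum_le_tsum hb ((hsumS.mul_left _).mul_left _)
      _ = 1 / 4 * (w 1 ^ v * S) := by rw [tsum_mul_left, tsum_mul_left]
  have hdiff' : N - 1 / 4 * Z = ∑' n, D (n + 1) := by
    rw [hdiff, hsumD.tsum_eq_zero_add, hD0, zero_add]
  have hZ0 : Z ≠ 0 := hZpos.ne'
  have hw00 : w 0 ≠ 0 := hw0.ne'
  have hkey : N / Z - 1 / 4 = (N - 1 / 4 * Z) / Z := by field_simp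
  rw [hkey, hdiff']
  refine ⟨div_nonneg htail_nonneg hZpos.le, ?_⟩
  rw [div_le_iff₀ hZpos]
  have hK : 0 ≤ 1 / 4 * r ^ v * (S / w 0) := by positivity
  have hw1e : w 1 ^ v = r ^ v * w 0 ^ v := by
    rw [hr, div_pow, div_mul_cancel₀]
    positivity
  calc ∑' n, D (n + 1) ≤ 1 / 4 * (w 1 ^ v * S) := htail_le
    _ = 1 / 4 * r ^ v * (S / w 0) * w 0 ^ (v + 1) := by
        rw [hw1e, pow_succ (w 0) v]
        field_simp
    _ ≤ 1 / 4 * r ^ v * (S / w 0) * Z := mul_le_mul_of_nonneg_left hZge hK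

end Abstract

/-! ## §2. The SU(2) torus: `⟨(½ tr P)²⟩ − ¼` is non-negative and exponentially small in the volume -/

/-- **`0 ≤ ⟨(½ tr P_j)²⟩_{(ℤ/L)²,β} − ¼ ≤ ¼ (I₂(2β)/I₁(2β))^{L²−1} · Σ_n I_{n+2}(2β)/I₁(2β)`** for `β > 0` and
every `L ≥ 1`: the mean square of the Polyakov loop exceeds the Haar second moment `¼` by an amount
exponentially small in the volume `L²`. -/
theorem wilson_mean_su2a0_sq_polyakov_two_sub_quarter_mem {L : ℕ} [NeZero L] {β : ℝ} (hβ : 0 < β)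
    (i j : ZMod L) :
    0 ≤ ∫ V, su2a0 (((List.range L).map fun a : ℕ => V (![i + a, j], 0)).prod) *
            su2a0 (((List.range L).map fun a : ℕ => V (![i + a, j], 0)).prod)
          ∂(wilsonMeasure (d := 2) (L := L) (fundamentalRep (Fin 2)) β) - 1 / 4 ∧
      ∫ V, su2a0 (((List.range L).map fun a : ℕ => V (![i + a, j], 0)).prod) *
            su2a0 (((List.range L).map fun a : ℕ => V (![i + a, j], 0)).prod)
          ∂(wilsonMeasure (d := 2) (L := L) (fundamentalRep (Fin 2)) β) - 1 / 4 ≤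
        1 / 4 * (besselI 2 (2 * β) / besselI 1 (2 * β)) ^ (L ^ 2 - 1) *
          ((∑' n : ℕ, besselI (n + 2) (2 * β)) / besselI 1 (2 * β)) := by
  set w : ℕ → ℝ := fun n => Real.exp (-(2 * β)) * (besselI n (2 * β) - besselI (n + 2) (2 * β)) /
    ((n : ℝ) + 1) with hw
  have hanti : Antitone w := charCoeff_div_succ_antitone hβ
  have hpos : ∀ n, 0 < w n := charCoeff_div_succ_pos hβ
  have hsum : Summable w := summable_charCoeff_div_succ hβ.le
  have hV : 1 ≤ L ^ 2 := Nat.one_le_pow _ _ (Nat.pos_of_ne_zero (NeZero.ne L))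
  have habs := tsum_ite_div_sub_quarter_mem hanti hpos hsum (L ^ 2) hV
  have hw' : ∀ n, w n = Real.exp (-(2 * β)) * besselI (n + 1) (2 * β) / β := fun n =>
    charCoeff_div_succ_eq_besselI n hβ.ne'
  have hI1 : 0 < besselI 1 (2 * β) := besselI_pos 1 (by linarith)
  have he : 0 < Real.exp (-(2 * β)) := Real.exp_pos _
  have hratio : w 1 / w 0 = besselI 2 (2 * β) / besselI 1 (2 * β) := by
    rw [hw' 1, hw' 0]
    field_simp
  have hS : (∑' n : ℕ, w (n + 1)) / w 0 = (∑' n : ℕ, besselI (n + 2) (2 * β)) / besselI 1 (2 * β) := by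
    have h1 : (fun n : ℕ => w (n + 1)) = fun n => (Real.exp (-(2 * β)) / β) * besselI (n + 2) (2 * β) := by
      funext n; rw [hw' (n + 1)]; ring
    rw [h1, tsum_mul_left, hw' 0]
    field_simp
  rw [wilson_mean_su2a0_sq_polyakov_two hβ.le i j, ← hratio, ← hS]
  exact habs

/-- **ELEMENTARY EXPLICIT FORM**: for `β > 0` and every `L ≥ 1`,
`0 ≤ ⟨(½ tr P_j)²⟩_{(ℤ/L)²,β} − ¼ ≤ ¼ (e^β − 1)·(β/2)^{L²−1}`. -/
theorem wilson_mean_su2a0_sq_polyakov_two_sub_quarter_mem_explicit {L : ℕ} [NeZero L] {β : ℝ}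
    (hβ : 0 < β) (i j : ZMod L) :
    0 ≤ ∫ V, su2a0 (((List.range L).map fun a : ℕ => V (![i + a, j], 0)).prod) *
            su2a0 (((List.range L).map fun a : ℕ => V (![i + a, j], 0)).prod)
          ∂(wilsonMeasure (d := 2) (L := L) (fundamentalRep (Fin 2)) β) - 1 / 4 ∧
      ∫ V, su2a0 (((List.range L).map fun a : ℕ => V (![i + a, j], 0)).prod) *
            su2a0 (((List.range L).map fun a : ℕ => V (![i + a, j], 0)).prod)
          ∂(wilsonMeasure (d := 2) (L := L) (fundamentalRep (Fin 2)) β) - 1 / 4 ≤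
        1 / 4 * (Real.exp β - 1) * (β / 2) ^ (L ^ 2 - 1) := by
  obtain ⟨h0, h⟩ := wilson_mean_su2a0_sq_polyakov_two_sub_quarter_mem hβ i j
  refine ⟨h0, h.trans ?_⟩
  have hx : (0 : ℝ) ≤ 2 * β := by linarith
  have hI1 : 0 < besselI 1 (2 * β) := besselI_pos 1 (by linarith)
  have hr : besselI 2 (2 * β) / besselI 1 (2 * β) ≤ β / 2 := by
    rw [div_le_iff₀ hI1]
    have := besselI_succ_le_div_mul 1 hx
    calc besselI 2 (2 * β) ≤ 2 * β / (2 * ((1 : ℕ) + 1)) * besselI 1 (2 * β) := this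
      _ = β / 2 * besselI 1 (2 * β) := by push_cast; ring
  have hr0 : 0 ≤ besselI 2 (2 * β) / besselI 1 (2 * β) := div_nonneg (besselI_nonneg 2 hx) hI1.le
  obtain ⟨_, hS⟩ := tsum_besselI_add_two_le hx
  have hS' : (∑' n : ℕ, besselI (n + 2) (2 * β)) / besselI 1 (2 * β) ≤ Real.exp β - 1 := by
    rw [div_le_iff₀ hI1]
    have h2 : 2 * β / 2 = β := by ring
    rw [h2] at hS
    exact hS
  have hS0 : 0 ≤ (∑' n : ℕ, besselI (n + 2) (2 * β)) / besselI 1 (2 * β) :=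
    div_nonneg (tsum_nonneg fun n => besselI_nonneg _ hx) hI1.le
  calc 1 / 4 * (besselI 2 (2 * β) / besselI 1 (2 * β)) ^ (L ^ 2 - 1) *
        ((∑' n : ℕ, besselI (n + 2) (2 * β)) / besselI 1 (2 * β))
      ≤ 1 / 4 * (β / 2) ^ (L ^ 2 - 1) * (Real.exp β - 1) := by
        have h1 : (besselI 2 (2 * β) / besselI 1 (2 * β)) ^ (L ^ 2 - 1) ≤ (β / 2) ^ (L ^ 2 - 1) :=
          pow_le_pow_left₀ hr0 hr _
        have h2 : 1 / 4 * (besselI 2 (2 * β) / besselI 1 (2 * β)) ^ (L ^ 2 - 1) ≤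
            1 / 4 * (β / 2) ^ (L ^ 2 - 1) := mul_le_mul_of_nonneg_left h1 (by norm_num)
        exact mul_le_mul h2 hS' hS0 (by positivity)
    _ = _ := by ring

/-! ## §3. The thermodynamic limit `⟨(½ tr P)²⟩ → ¼` -/

/-- **THE THERMODYNAMIC LIMIT OF THE POLYAKOV-LOOP MEAN SQUARE.**  For `β > 0`,
`⟨(½ tr P_0)²⟩_{(ℤ/(L+1))²,β} → ¼ = ∫_{SU(2)} (½ tr U)² dU` as `L → ∞` (the loop through the origin; every
base point obeys the same bound). -/
theorem tendsto_wilson_mean_su2a0_sq_polyakov_two {β : ℝ} (hβ : 0 < β) :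
    Tendsto (fun L : ℕ => ∫ V,
        su2a0 (((List.range (L + 1)).map fun a : ℕ => V (![(0 : ZMod (L + 1)) + a, 0], 0)).prod) *
          su2a0 (((List.range (L + 1)).map fun a : ℕ => V (![(0 : ZMod (L + 1)) + a, 0], 0)).prod)
        ∂(wilsonMeasure (d := 2) (L := L + 1) (fundamentalRep (Fin 2)) β))
      atTop (𝓝 (1 / 4)) := by
  obtain ⟨hr0, hr1⟩ := besselI_two_div_one_lt_one hβ
  set r : ℝ := besselI 2 (2 * β) / besselI 1 (2 * β) with hr
  set K : ℝ := (∑' n : ℕ, besselI (n + 2) (2 * β)) / besselI 1 (2 * β) with hK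
  have hexp : Tendsto (fun L : ℕ => (L + 1) ^ 2 - 1) atTop atTop := by
    refine tendsto_atTop_mono (fun L => ?_) tendsto_id
    have : (L + 1) ^ 2 = L * L + 2 * L + 1 := by ring
    simp only [id_eq]
    omega
  have hpow : Tendsto (fun L : ℕ => r ^ ((L + 1) ^ 2 - 1)) atTop (𝓝 0) :=
    (tendsto_pow_atTop_nhds_zero_of_lt_one hr0 hr1).comp hexp
  have hbound : Tendsto (fun L : ℕ => 1 / 4 * r ^ ((L + 1) ^ 2 - 1) * K) atTop (𝓝 0) := by
    simpa using (hpow.const_mul (1 / 4 : ℝ)).mul_const K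
  rw [tendsto_iff_norm_sub_tendsto_zero]
  refine squeeze_zero (fun L => norm_nonneg _) (fun L => ?_) hbound
  rw [Real.norm_eq_abs]
  obtain ⟨h0, h1⟩ := wilson_mean_su2a0_sq_polyakov_two_sub_quarter_mem (L := L + 1) hβ 0 0
  rw [abs_of_nonneg h0]
  exact h1

end Summit.Ventures.LatticeQCDFlow.Scoring
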